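import Summits.ResolutionOfSingularities.ResolutionOfSingularities.Theorems.WeightedInvariantE2SpanCriterion
import HarnessLib

/-!
# E2 centre, (G-0-U) `E2HomogeneousSpanBody`, part 2: HOMOGENEOUS RE-PRESENTATION of a weighted filtration at a prime of a
# graded ring, and SPREADING to a basic open neighbourhood

[OURS · L1 W4.3 · DOOR `HypersurfaceCentreConstruction` stmt-ResolutionOfSingularities-19897 · E2 tier, centre piece (C-c), hand
(G-0-U) = board (o47-c-U) `E2HomogeneousSpanBody p ι J` (registrar res-L1-w43-plan-1, SPEC (Δ11) rev 9/10 l.718; route (U-b)+(U-c));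
res-D-pv-031 (gen 11).  Pure commutative algebra over Mathlib's graded rings and part 1 (`…E2SpanCriterion`); nothing here is a
statement of the manuscript under adjudication [Hironaka2017]; candidate-design support, AI-written, weaker than expert review.]

* `exists_isHomogeneousElem_ideal_eq` — (U-b): `A` Noetherian, graded by `𝒜 : (Fin j → ℤ) → AddSubgroup A`, `𝔪` a prime, `S = A_𝔪`;
  `U : Fin N → A` with positive weights `W`, `U ⊆ 𝔪 S` cotangent-independent in `S`, and (U-a) as HYPOTHESIS: every contraction
  `A ∩ 𝒥_{Wₗ}(U, W) S` is `𝒜`-homogeneous.  Then there is `U' : Fin N → A` with every `U'ᵢ` HOMOGENEOUS, the same weighted filtration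
  in `S` in every degree, and cotangent-independent (iterate the exchange step of part 1 over the indices, candidates = the homogeneous
  components of the current generator — they lie in the contracted piece because it is homogeneous).
* `exists_not_mem_forall_ideal_eq` — (U-c) SPREADING by MONOTONICITY: two families with the same weighted filtration in `A_𝔪` have the
  same weighted filtration in `A_𝔮`, and cut out the same primes, for every prime `𝔮` of a basic open neighbourhood `D(h')` of `𝔪`
  (`2N` memberships, one common denominator).
-/

set_option linter.dupNamespace false -- mandated namespace of this single-conjunct summit

noncomputable section

open IsLocalRing Literature.AlgebraicGeometry.Resolution DirectSum

namespace Summit.ResolutionOfSingularities.ResolutionOfSingularities.Cruxes.HypersurfaceCentreConstruction.LocalEngine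

namespace E2Span

/-! ## Transport of cotangent independence along an equality of families -/

section Transport

variable {S : Type} [CommRing S] [IsLocalRing S] {ι : Type}

/-- Cotangent independence is a property of the family (transport along `u = v`). [folklore] -/
theorem linearIndependent_toCotangent_congr {u v : ι → S} (h : u = v) (hu : ∀ i, u i ∈ maximalIdeal S)
    (hli : LinearIndependent (ResidueField S) (fun i => (maximalIdeal S).toCotangent ⟨u i, hu i⟩)) :
    ∃ hv : ∀ i, v i ∈ maximalIdeal S,
      LinearIndependent (ResidueField S) (fun i => (maximalIdeal S).toCotangent ⟨v i, hv i⟩) := by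
  subst h
  exact ⟨hu, hli⟩

end Transport

/-! ## (U-b) Homogeneous re-presentation -/

section Graded

variable {A : Type} [CommRing A] [IsNoetherianRing A] {j : ℕ} (𝒜 : (Fin j → ℤ) → AddSubgroup A) [GradedRing 𝒜]
  (𝔪 : Ideal A) [𝔪.IsPrime]

/-- **(U-b) HOMOGENEOUS RE-PRESENTATION.**  Let `A` be Noetherian and `ℤʲ`-graded, `𝔪` a prime, `S = A_𝔪`, `U : Fin N → A` with
positive weights `W` whose images lie in `𝔪 S` and are linearly independent in `𝔪S/(𝔪S)²`, and suppose (U-a): for every `l` the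
contraction `A ∩ 𝒥_{Wₗ}(U, W)·S` is a HOMOGENEOUS ideal.  Then there is `U' : Fin N → A`, every `U'ᵢ` homogeneous, with
`𝒥ₙ(U', W)·S = 𝒥ₙ(U, W)·S` for every `n` and cotangent-independent images.  Proof: exchange the generators one at a time for one
of their homogeneous components (part 1 `exists_update_eq`); the contracted pieces do not change along the way. [OURS] -/
theorem exists_isHomogeneousElem_ideal_eq {N : ℕ} (U : Fin N → A) (W : Fin N → ℕ) (hW : ∀ i, 1 ≤ W i)
    (hU : ∀ i, algebraMap A (Localization.AtPrime 𝔪) (U i) ∈ maximalIdeal (Localization.AtPrime 𝔪))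
    (hli : LinearIndependent (ResidueField (Localization.AtPrime 𝔪))
      (fun i => (maximalIdeal (Localization.AtPrime 𝔪)).toCotangent ⟨_, hU i⟩))
    (hhom : ∀ l, (((weightedFiltration (fun i => algebraMap A (Localization.AtPrime 𝔪) (U i)) W).ideal (W l)).comap
      (algebraMap A (Localization.AtPrime 𝔪))).IsHomogeneous 𝒜) :
    ∃ U' : Fin N → A, (∀ i, SetLike.IsHomogeneousElem 𝒜 (U' i)) ∧
      (∀ n, (weightedFiltration (fun i => algebraMap A (Localization.AtPrime 𝔪) (U' i)) W).ideal n =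
        (weightedFiltration (fun i => algebraMap A (Localization.AtPrime 𝔪) (U i)) W).ideal n) ∧
      ∃ hU' : ∀ i, algebraMap A (Localization.AtPrime 𝔪) (U' i) ∈ maximalIdeal (Localization.AtPrime 𝔪),
        LinearIndependent (ResidueField (Localization.AtPrime 𝔪))
          (fun i => (maximalIdeal (Localization.AtPrime 𝔪)).toCotangent ⟨_, hU' i⟩) := by
  classical
  set S := Localization.AtPrime 𝔪 with hS
  -- induction over a finite set of indices already made homogeneous
  suffices key : ∀ s : Finset (Fin N), ∃ U' : Fin N → A, (∀ i ∈ s, SetLike.IsHomogeneousElem 𝒜 (U' i)) ∧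
      (∀ n, (weightedFiltration (fun i => algebraMap A S (U' i)) W).ideal n =
        (weightedFiltration (fun i => algebraMap A S (U i)) W).ideal n) ∧
      ∃ hU' : ∀ i, algebraMap A S (U' i) ∈ maximalIdeal S,
        LinearIndependent (ResidueField S) (fun i => (maximalIdeal S).toCotangent ⟨_, hU' i⟩) by
    obtain ⟨U', h1, h2, h3⟩ := key Finset.univ
    exact ⟨U', fun i => h1 i (Finset.mem_univ i), h2, h3⟩
  intro s
  induction s using Finset.induction_on with
  | empty => exact ⟨U, fun i hi => absurd hi (Finset.notMem_empty i), fun n => rfl, hU, hli⟩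
  | insert l s hl ih =>
    obtain ⟨U', hhomU', hfil, hU', hli'⟩ := ih
    -- the candidates: the homogeneous components of `U' l`
    set x := U' l with hx
    have hcomp : ∀ d, algebraMap A S (decompose 𝒜 x d : A) ∈
        (weightedFiltration (fun i => algebraMap A S (U' i)) W).ideal (W l) := by
      intro d
      have hcontr : (((weightedFiltration (fun i => algebraMap A S (U' i)) W).ideal (W l)).comap
          (algebraMap A S)).IsHomogeneous 𝒜 := by
        rw [hfil (W l)]; exact hhom l
      have hxmem : x ∈ ((weightedFiltration (fun i => algebraMap A S (U' i)) W).ideal (W l)).comap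
          (algebraMap A S) :=
        Ideal.mem_comap.mpr (mem_weightedFiltration_ideal (fun i => algebraMap A S (U' i)) W l)
      exact Ideal.mem_comap.mp (hcontr d hxmem)
    have hsum : ∑ d ∈ (decompose 𝒜 x).support, algebraMap A S (decompose 𝒜 x d : A) = algebraMap A S (U' l) := by
      rw [← map_sum, sum_support_decompose 𝒜 x]
    -- exchange
    obtain ⟨g, hfil', hu'', hli''⟩ := exists_update_eq (fun i => algebraMap A S (U' i)) W hW hU' hli' l
      (fun d : (decompose 𝒜 x).support => algebraMap A S (decompose 𝒜 x d.1 : A))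
      (fun d => hcomp d.1)
      (by rw [← hsum]; exact Finset.sum_coe_sort (decompose 𝒜 x).support (fun d => algebraMap A S (decompose 𝒜 x d : A)))
    set c : A := (decompose 𝒜 x g.1 : A) with hc
    have hupd : Function.update (fun i => algebraMap A S (U' i)) l (algebraMap A S c) =
        fun i => algebraMap A S (Function.update U' l c i) := by
      funext i
      by_cases hi : i = l
      · subst hi; simp
      · simp [Function.update_of_ne hi]
    refine ⟨Function.update U' l c, ?_, ?_, ?_⟩
    · intro i hi
      rcases Finset.mem_insert.mp hi with rfl | hi'
      · rw [Function.update_self]; exact ⟨g.1, (decompose 𝒜 x g.1).2⟩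
      · have hne : i ≠ l := fun h => hl (h ▸ hi')
        rw [Function.update_of_ne hne]; exact hhomU' i hi'
    · intro n
      rw [← hfil n, ← hfil' n, hupd]
    · exact linearIndependent_toCotangent_congr hupd hu'' hli''

end Graded

/-! ## (U-c) Spreading to a basic open neighbourhood -/

section Spread

variable {A : Type} [CommRing A] (𝔪 : Ideal A) [𝔪.IsPrime]

/-- One direction of the spreading: memberships `U'ₖ/1 ∈ 𝒥_{W'ₖ}(U, W)·A_𝔪` clear ONE denominator `s ∉ 𝔪`, and then hold in
`A_𝔮` for every prime `𝔮 ∌ s`; moreover there `U ⊆ 𝔮` forces `U'ₖ ∈ 𝔮` whenever `W'ₖ ≥ 1`. [folklore] -/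
theorem exists_not_mem_forall_mem {N N' : ℕ} (U : Fin N → A) (W : Fin N → ℕ) (U' : Fin N' → A) (W' : Fin N' → ℕ)
    (h : ∀ k, algebraMap A (Localization.AtPrime 𝔪) (U' k) ∈
      (weightedFiltration (fun i => algebraMap A (Localization.AtPrime 𝔪) (U i)) W).ideal (W' k)) :
    ∃ s : A, s ∉ 𝔪 ∧ ∀ (𝔮 : Ideal A) [𝔮.IsPrime], s ∉ 𝔮 →
      (∀ k, algebraMap A (Localization.AtPrime 𝔮) (U' k) ∈
        (weightedFiltration (fun i => algebraMap A (Localization.AtPrime 𝔮) (U i)) W).ideal (W' k)) ∧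
      ((∀ i, U i ∈ 𝔮) → ∀ k, 1 ≤ W' k → U' k ∈ 𝔮) := by
  classical
  -- clear denominators index by index
  have hk : ∀ k, ∃ s : A, s ∉ 𝔪 ∧ s * U' k ∈ (weightedFiltration U W).ideal (W' k) := by
    intro k
    have hk : algebraMap A (Localization.AtPrime 𝔪) (U' k) ∈
        ((weightedFiltration U W).ideal (W' k)).map (algebraMap A (Localization.AtPrime 𝔪)) := by
      rw [map_weightedFiltration_ideal]; exact h k
    obtain ⟨s, hs, hsU⟩ :=
      (IsLocalization.algebraMap_mem_map_algebraMap_iff 𝔪.primeCompl (Localization.AtPrime 𝔪) _ _).mp hk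
    exact ⟨s, hs, hsU⟩
  choose s hs hsU using hk
  refine ⟨∏ k, s k, fun hmem => ?_, fun 𝔮 _ hq => ?_⟩
  · obtain ⟨k, -, hk⟩ := Ideal.IsPrime.prod_mem_iff.mp hmem
    exact hs k hk
  have hsk : ∀ k, s k ∉ 𝔮 := fun k hk => hq (Ideal.IsPrime.prod_mem_iff.mpr ⟨k, Finset.mem_univ k, hk⟩)
  refine ⟨fun k => ?_, fun hUq k hWk => ?_⟩
  · have hunit : IsUnit (algebraMap A (Localization.AtPrime 𝔮) (s k)) :=
      IsLocalization.map_units _ ⟨s k, show s k ∈ 𝔮.primeCompl from hsk k⟩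
    have hmem : algebraMap A (Localization.AtPrime 𝔮) (s k * U' k) ∈
        (weightedFiltration (fun i => algebraMap A (Localization.AtPrime 𝔮) (U i)) W).ideal (W' k) := by
      have := Ideal.mem_map_of_mem (algebraMap A (Localization.AtPrime 𝔮)) (hsU k)
      rwa [map_weightedFiltration_ideal] at this
    rw [map_mul] at hmem
    have := Ideal.mul_mem_left _ (↑(hunit.unit⁻¹) : Localization.AtPrime 𝔮) hmem
    rwa [← mul_assoc, IsUnit.val_inv_mul, one_mul] at this
  · have hmem : s k * U' k ∈ 𝔮 :=
      (ideal_le_span U W hWk (hsU k) |> Ideal.span_le.mpr (Set.range_subset_iff.mpr hUq))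
    exact ((‹𝔮.IsPrime›).mem_or_mem hmem).resolve_left (hsk k)

/-- **(U-c) SPREADING.**  Two families `U, U'` (positive weights) each lying in the other's weighted filtration in `A_𝔪` — e.g.
with the SAME weighted filtration in `A_𝔪` — cut out the same primes and have the same weighted filtration in `A_𝔮`, in every
degree, for every prime `𝔮` of a basic open neighbourhood `D(s) ∋ 𝔪` (monotonicity, part 1a; one common denominator). [OURS] -/
theorem exists_not_mem_forall_ideal_eq {N N' : ℕ} (U : Fin N → A) (W : Fin N → ℕ) (U' : Fin N' → A) (W' : Fin N' → ℕ)
    (hW : ∀ i, 1 ≤ W i) (hW' : ∀ k, 1 ≤ W' k)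
    (h : ∀ k, algebraMap A (Localization.AtPrime 𝔪) (U' k) ∈
      (weightedFiltration (fun i => algebraMap A (Localization.AtPrime 𝔪) (U i)) W).ideal (W' k))
    (h' : ∀ l, algebraMap A (Localization.AtPrime 𝔪) (U l) ∈
      (weightedFiltration (fun i => algebraMap A (Localization.AtPrime 𝔪) (U' i)) W').ideal (W l)) :
    ∃ s : A, s ∉ 𝔪 ∧ ∀ (𝔮 : Ideal A) [𝔮.IsPrime], s ∉ 𝔮 →
      ((∀ k, U' k ∈ 𝔮) ↔ (∀ i, U i ∈ 𝔮)) ∧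
      ∀ n, (weightedFiltration (fun i => algebraMap A (Localization.AtPrime 𝔮) (U' i)) W').ideal n =
        (weightedFiltration (fun i => algebraMap A (Localization.AtPrime 𝔮) (U i)) W).ideal n := by
  obtain ⟨s₁, hs₁, H₁⟩ := exists_not_mem_forall_mem 𝔪 U W U' W' h
  obtain ⟨s₂, hs₂, H₂⟩ := exists_not_mem_forall_mem 𝔪 U' W' U W h'
  refine ⟨s₁ * s₂, fun hmem => ((‹𝔪.IsPrime›).mem_or_mem hmem).elim hs₁ hs₂, fun 𝔮 _ hq => ?_⟩
  have hq₁ : s₁ ∉ 𝔮 := fun h₁ => hq (Ideal.mul_mem_right _ _ h₁)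
  have hq₂ : s₂ ∉ 𝔮 := fun h₂ => hq (Ideal.mul_mem_left _ _ h₂)
  obtain ⟨hm₁, hz₁⟩ := H₁ 𝔮 hq₁
  obtain ⟨hm₂, hz₂⟩ := H₂ 𝔮 hq₂
  exact ⟨⟨fun hU' i => hz₂ hU' i (hW i), fun hU k => hz₁ hU k (hW' k)⟩,
    ideal_eq_of_forall_mem_of_forall_mem _ W _ W' hm₁ hm₂⟩

/-- The same from an EQUALITY of the two weighted filtrations in `A_𝔪`. [OURS] -/
theorem exists_not_mem_forall_ideal_eq_of_eq {N N' : ℕ} (U : Fin N → A) (W : Fin N → ℕ) (U' : Fin N' → A)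
    (W' : Fin N' → ℕ) (hW : ∀ i, 1 ≤ W i) (hW' : ∀ k, 1 ≤ W' k)
    (heq : ∀ n, (weightedFiltration (fun i => algebraMap A (Localization.AtPrime 𝔪) (U' i)) W').ideal n =
      (weightedFiltration (fun i => algebraMap A (Localization.AtPrime 𝔪) (U i)) W).ideal n) :
    ∃ s : A, s ∉ 𝔪 ∧ ∀ (𝔮 : Ideal A) [𝔮.IsPrime], s ∉ 𝔮 →
      ((∀ k, U' k ∈ 𝔮) ↔ (∀ i, U i ∈ 𝔮)) ∧
      ∀ n, (weightedFiltration (fun i => algebraMap A (Localization.AtPrime 𝔮) (U' i)) W').ideal n =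
        (weightedFiltration (fun i => algebraMap A (Localization.AtPrime 𝔮) (U i)) W).ideal n :=
  exists_not_mem_forall_ideal_eq 𝔪 U W U' W' hW hW'
    (fun k => by rw [← heq]; exact mem_weightedFiltration_ideal _ W' k)
    (fun l => by rw [heq]; exact mem_weightedFiltration_ideal _ W l)

end Spread

end E2Span

end Summit.ResolutionOfSingularities.ResolutionOfSingularities.Cruxes.HypersurfaceCentreConstruction.LocalEngine

end
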